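import Summits.Ventures.DiscreteObjects.PP12.FlagPencilCensus
import Summits.Ventures.DiscreteObjects.PP12.FlagTenIndexSets

/-!
# Shape facts of the `f = 10` flag sub-cell: the c-line orbit, one vertex on `u₀`, and the owner of the foreign side (kernel; Steps B/C groundwork)
Framing: lottery ticket; floor = certified bounds/negative ranges.

Cell pub-namedobj (venture DiscreteObjects), target (M), designs gen 13 (HOME FAMILY-FLAG7X §7). Order 12, flag type, `σ³ = 1`, exactly 10 fixed
points. The data `φ, γ, C, β` of `FlagTenOrbitData` are read off a chosen non-fixed line `u₀ ∋ c`; this file supplies the facts making that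
reading well defined:
* `card_clines_not_fixed` — exactly three lines through `c` are not fixed, and (`clines_eq_orb3`) they form ONE orbit `{u₀, σu₀, σ²u₀}`;
* `exterior_orbit_meets_cline` — the orbit-triangle of every exterior point has a (unique, `card_orb3_inter_cline_le_one`) vertex on `u₀`:
  the triangles are indexed by the 12 points `≠ c` of `u₀`;
* `foreign_side_owner` — the unique foreign side through an exterior point `x` (`FlagSideCensus.existsUnique_foreign_side`) is a side of the
  orbit-triangle of some exterior `Q` with `orb3 Q ≠ orb3 x` — the map `φ` ('`i` is inscribed in `φ i`') is well defined with `φ i ≠ i`;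
  `FlagInscribed.not_mutually_inscribed` excludes 2-cycles.
No `sorry`, no new axioms.
-/

namespace Summit.Ventures.DiscreteObjects.PP12

open Configuration Finset
open scoped Classical

namespace Collineation

variable {P L : Type*} [Membership P L] [ProjectivePlane P L] [Fintype P] [Fintype L] (σ : Collineation P L)

section Flag

variable {l : L} {c : P} (hl : σ.onLines l = l) (hc : σ.onPoints c = c) (hcl : c ∈ l)
  (hP : ∀ p : P, σ.onPoints p = p → p ∈ l) (hL : ∀ m : L, σ.onLines m = m → c ∈ m)
  (h12 : ProjectivePlane.order P L = 12)

include hL h12 in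
/-- **Exactly `13 − f` lines through `c` are not fixed** (all fixed lines pass through `c`); for `f = 10`: three. -/
theorem card_clines_not_fixed (hf : fixedCard σ.onPoints = 10) :
    (univ.filter fun u : L => c ∈ u ∧ σ.onLines u ≠ u).card = 3 := by
  have hall : (univ.filter fun u : L => c ∈ u).card = 13 := by rw [card_lines_through, h12]
  have hfix : (univ.filter fun u : L => σ.onLines u = u).card = 10 := by
    change fixedCard σ.onLines = 10; rw [← σ.fixedCard_points_eq_lines, hf]
  -- the fixed lines are exactly the lines through c that are fixed
  have hsplit := Finset.card_filter_add_card_filter_not (s := univ.filter fun u : L => c ∈ u) (fun u => σ.onLines u = u)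
  rw [Finset.filter_filter, Finset.filter_filter, hall] at hsplit
  have h1 : (univ.filter fun u : L => c ∈ u ∧ σ.onLines u = u) = univ.filter fun u : L => σ.onLines u = u := by
    ext u; simp only [mem_filter, mem_univ, true_and]; exact ⟨fun h => h.2, fun h => ⟨hL u h, h⟩⟩
  have h2 : (univ.filter fun u : L => c ∈ u ∧ σ.onLines u ≠ u) = univ.filter fun u : L => c ∈ u ∧ ¬ σ.onLines u = u := rfl
  rw [h1, hfix] at hsplit
  rw [h2]; omega

include hc hL h12 in
/-- **The non-fixed lines through `c` form one orbit** (`f = 10`, `σ³ = 1`): for any non-fixed `u₀ ∋ c`, every non-fixed line through `c`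
lies in `orb3 u₀`. -/
theorem clines_eq_orb3 (hq : σ.onPoints ^ 3 = 1) (hf : fixedCard σ.onPoints = 10) {u₀ : L} (hcu₀ : c ∈ u₀) (hu₀ : σ.onLines u₀ ≠ u₀)
    {u : L} (hcu : c ∈ u) (hu : σ.onLines u ≠ u) : u ∈ orb3 σ.onLines u₀ := by
  have hqL : σ.onLines ^ 3 = 1 := σ.onLines_pow_eq_one hq
  set U : Finset L := univ.filter fun u : L => c ∈ u ∧ σ.onLines u ≠ u with hU
  have hU3 : U.card = 3 := σ.card_clines_not_fixed hL h12 hf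
  -- orb3 u₀ ⊆ U and both have three elements
  have hcσ : ∀ v : L, c ∈ v → c ∈ σ.onLines v := fun v hv => by have := σ.mem_map hv; rwa [hc] at this
  have hnfσ : ∀ v : L, σ.onLines v ≠ v → σ.onLines (σ.onLines v) ≠ σ.onLines v := fun v hv e => hv (σ.onLines.injective e)
  have hsub : orb3 σ.onLines u₀ ⊆ U := by
    intro v hv; rw [mem_orb3] at hv; rw [hU, mem_filter]
    rcases hv with rfl | rfl | rfl
    · exact ⟨mem_univ _, hcu₀, hu₀⟩
    · exact ⟨mem_univ _, hcσ _ hcu₀, hnfσ _ hu₀⟩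
    · exact ⟨mem_univ _, hcσ _ (hcσ _ hcu₀), hnfσ _ (hnfσ _ hu₀)⟩
  have heq : orb3 σ.onLines u₀ = U :=
    Finset.eq_of_subset_of_card_le hsub (by rw [hU3, card_orb3_of_ne _ hqL hu₀])
  have : u ∈ U := by rw [hU, mem_filter]; exact ⟨mem_univ _, hcu, hu⟩
  rw [← heq] at this; exact this

include hl hc hcl hL h12 in
/-- **Every exterior orbit-triangle has a vertex on `u₀`** (`f = 10`): for an exterior point `Q` and a non-fixed line `u₀ ∋ c` some point of
`orb3 Q` lies on `u₀` (and only one, `FlagSideCensus.card_orb3_inter_cline_le_one`). -/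
theorem exterior_orbit_meets_cline (hq : σ.onPoints ^ 3 = 1) (hf : fixedCard σ.onPoints = 10) {u₀ : L} (hcu₀ : c ∈ u₀)
    (hu₀ : σ.onLines u₀ ≠ u₀) {Q : P} (hQX : ∀ m : L, σ.onLines m = m → Q ∉ m) : ∃ x ∈ orb3 σ.onPoints Q, x ∈ u₀ := by
  -- the c-line of Q
  have hQc : Q ≠ c := fun e => hQX l hl (e ▸ hcl)
  set u : L := HasLines.mkLine hQc with hu
  have hQu : Q ∈ u := (HasLines.mkLine_ax hQc).1
  have hcu : c ∈ u := (HasLines.mkLine_ax hQc).2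
  have hnu : σ.onLines u ≠ u := fun e => hQX u e hQu
  have hmem := σ.clines_eq_orb3 hc hL h12 hq hf hcu₀ hu₀ hcu hnu
  -- u = σ^a u₀, so σ^(3-a) Q ∈ u₀
  have h3L : σ.onLines (σ.onLines (σ.onLines u₀)) = u₀ := apply_three σ.onLines (σ.onLines_pow_eq_one hq) u₀
  rw [mem_orb3] at hmem
  rcases hmem with e | e | e
  · exact ⟨Q, self_mem_orb3 _ _, e ▸ hQu⟩
  · refine ⟨σ.onPoints (σ.onPoints Q), (mem_orb3 _ _ _).2 (Or.inr (Or.inr rfl)), ?_⟩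
    have := σ.mem_map (σ.mem_map hQu); rw [e, h3L] at this; exact this
  · refine ⟨σ.onPoints Q, (mem_orb3 _ _ _).2 (Or.inr (Or.inl rfl)), ?_⟩
    have := σ.mem_map hQu; rw [e, h3L] at this; exact this

include hl hc hcl hP hL in
/-- **The owner of the foreign side.** If `x` is exterior and `f ∋ x` is an exterior line (no fixed point) that is not one of the two own
sides of `x` (`σx ∉ f`, `σ²x ∉ f`), then `f` is a side of the orbit-triangle of some exterior point `Q` (`Q, σQ ∈ f`) with
`orb3 Q ≠ orb3 x` — `x` is inscribed in a DIFFERENT triangle (`φ i ≠ i`). Needs `σ³ = 1` only for the orbit bookkeeping. -/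
theorem foreign_side_owner (hq : σ.onPoints ^ 3 = 1) {x : P} (hxX : ∀ m : L, σ.onLines m = m → x ∉ m) {f : L} (hxf : x ∈ f)
    (hf0 : ∀ p : P, σ.onPoints p = p → p ∉ f) (h1 : σ.onPoints x ∉ f) (h2 : σ.onPoints (σ.onPoints x) ∉ f) :
    ∃ Q : P, (σ.onPoints Q ≠ Q ∧ ∀ m : L, σ.onLines m = m → Q ∉ m) ∧ Q ∈ f ∧ σ.onPoints Q ∈ f ∧
      orb3 σ.onPoints Q ≠ orb3 σ.onPoints x := by
  have hx : σ.onPoints x ≠ x := σ.not_fixed_of_exterior_flag hl hP hxX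
  have hnf : σ.onLines f ≠ f := fun e => hxX f e hxf
  obtain ⟨Q, hQ, hQf, hσQf⟩ := σ.exterior_line_is_side hl hc hcl hP hL hnf hf0
  refine ⟨Q, hQ, hQf, hσQf, fun e => ?_⟩
  -- if Q were in the orbit of x, f would contain two points of orb3 x, i.e. be an own side or make the orbit collinear
  have hQx : Q ∈ orb3 σ.onPoints x := by rw [← e]; exact self_mem_orb3 _ _
  have h3 : σ.onPoints (σ.onPoints (σ.onPoints x)) = x := apply_three σ.onPoints hq x
  rw [mem_orb3] at hQx
  rcases hQx with rfl | rfl | rfl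
  · exact h1 hσQf
  · exact h2 hσQf
  · rw [h3] at hσQf; exact h2 hQf

end Flag

end Collineation

end Summit.Ventures.DiscreteObjects.PP12
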